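import Mathlib

/-!
# Lines in zero loci and the translation lemma

Elementary facts about affine lines `s ↦ z + s • v` inside the zero locus `Z_K(J) ⊆ K^ι` of an
ideal `J ⊆ k[X_ι]` over a coefficient field `k ⊆ K` (Hartshorne, *Algebraic Geometry*, I §1;
Shafarevich, *Basic Algebraic Geometry 1*, Ch. I):

* `eval_aeval_lineMap` — the restriction of a polynomial to a parametrised line is a univariate
  polynomial: `p(z + s v) = (p ∘ line)(s)`;
* `add_smul_mem_zeroLocus_of_infinite` — **a line meeting `Z_K(J)` in infinitely many points lies
  in it**;
* `aeval_aeval_translate` — translating the variables and evaluating is evaluating at the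
  translated point;
* `add_smul_mem_zeroLocus_of_mem_closure` — **translation lemma**: if the line in direction `v`
  through every point of a set `T` lies in `Z_K(J)`, then so does the line through every point of
  the Zariski closure `Z_K(I_K(T))` of `T` (the condition "`z + K v ⊆ Z_K(J)`" is Zariski closed
  in `z`: it is `⋂ₛ (Z_K(J) - s v)`);
* `add_mem_zeroLocus_of_mem_span` — hence a closed set in whose `K`-dense subset `T` every point
  carries the lines in the directions `v ∈ V` is invariant under translation by `span_K V`;
* `image_add_smul_zeroLocus_eq` — and `Z_K(J) + s v = Z_K(J)`.

## References

* [Hartshorne1977] R. Hartshorne, *Algebraic Geometry*, Springer GTM 52 (1977), Ch. I §1.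
* [Shafarevich1994] I. R. Shafarevich, *Basic Algebraic Geometry 1*, 2nd ed., Springer (1994),
  Ch. I §2–§3 (closed subsets of affine space, regular maps are continuous).
-/

noncomputable section

namespace Literature.RingTheory.MvPolynomial

open _root_.MvPolynomial

variable {k K : Type*} [Field k] [Field K] [Algebra k K] {ι : Type*}

/-! ### Restriction of a polynomial to a line -/

/-- **Restriction to a line.** For `p ∈ k[X_ι]`, `z, v ∈ K^ι` and `s ∈ K`:
`p(z + s • v)` is the value at `s` of the univariate polynomial `p(z_i + v_i S)_i ∈ K[S]`.
[folklore] -/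
theorem eval_aeval_lineMap (z v : ι → K) (p : MvPolynomial ι k) (s : K) :
    Polynomial.eval s
        (aeval (fun i => Polynomial.C (z i) + Polynomial.C (v i) * Polynomial.X) p) =
      aeval (z + s • v) p := by
  have h : ((Polynomial.aeval s : Polynomial K →ₐ[K] K).restrictScalars k).comp
      (aeval (fun i => Polynomial.C (z i) + Polynomial.C (v i) * Polynomial.X)) =
      (aeval (z + s • v) : MvPolynomial ι k →ₐ[k] K) := by
    refine MvPolynomial.algHom_ext fun i => ?_
    simp only [AlgHom.coe_comp, AlgHom.coe_restrictScalars', Function.comp_apply, aeval_X,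
      map_add, map_mul, Polynomial.aeval_C, Polynomial.aeval_X, Pi.add_apply, Pi.smul_apply,
      smul_eq_mul]
    simp [mul_comm]
  have := congrArg (fun φ : MvPolynomial ι k →ₐ[k] K => φ p) h
  simpa [Polynomial.coe_aeval_eq_eval] using this

/-- **A line meeting a zero locus in infinitely many points lies in it**: if `z + s • v ∈ Z_K(J)`
for infinitely many `s ∈ K`, then for all `s` (each `p ∈ J` restricts to a univariate polynomial
with infinitely many roots). [cite: Shafarevich1994, Ch. I §3] -/
theorem add_smul_mem_zeroLocus_of_infinite (J : Ideal (MvPolynomial ι k)) {z v : ι → K}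
    (h : {s : K | z + s • v ∈ zeroLocus K J}.Infinite) (s : K) : z + s • v ∈ zeroLocus K J := by
  rw [mem_zeroLocus_iff]
  intro p hp
  have h0 : aeval (fun i => Polynomial.C (z i) + Polynomial.C (v i) * Polynomial.X) p = 0 := by
    refine Polynomial.eq_zero_of_infinite_isRoot _ (h.mono fun t ht => ?_)
    simp only [Set.mem_setOf_eq, Polynomial.IsRoot.def, eval_aeval_lineMap]
    exact (mem_zeroLocus_iff.1 ht) p hp
  rw [← eval_aeval_lineMap, h0, Polynomial.eval_zero]

/-! ### The translation lemma -/

/-- **Translate, then evaluate = evaluate at the translated point**: for `p ∈ k[X_ι]` and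
`t, w ∈ K^ι`, `(p(X + w))(t) = p(t + w)`. [folklore] -/
theorem aeval_aeval_translate (t w : ι → K) (p : MvPolynomial ι k) :
    aeval t (aeval (fun i => (X i : MvPolynomial ι K) + C (w i)) p) = aeval (t + w) p := by
  have h : ((aeval t : MvPolynomial ι K →ₐ[K] K).restrictScalars k).comp
      (aeval (fun i => (X i : MvPolynomial ι K) + C (w i))) =
      (aeval (t + w) : MvPolynomial ι k →ₐ[k] K) := by
    refine MvPolynomial.algHom_ext fun i => ?_
    simp
  exact congrArg (fun φ : MvPolynomial ι k →ₐ[k] K => φ p) h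

/-- **Translation lemma.** If the line `z + K • v` through every point `z` of a set `T ⊆ K^ι`
lies in the zero locus `Z_K(J)` (`J ⊆ k[X_ι]`), then so does the line through every point of
the Zariski closure `Z_K(I_K(T))` of `T`: for fixed `s`, the translate `p(X + s v)` of each
`p ∈ J` vanishes on `T`, hence on its closure. [cite: Hartshorne1977, I §1] -/
theorem add_smul_mem_zeroLocus_of_mem_closure (J : Ideal (MvPolynomial ι k)) {T : Set (ι → K)}
    {v : ι → K} (hT : ∀ z ∈ T, ∀ s : K, z + s • v ∈ zeroLocus K J) {z : ι → K}
    (hz : z ∈ zeroLocus K (vanishingIdeal K T)) (s : K) : z + s • v ∈ zeroLocus K J := by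
  rw [mem_zeroLocus_iff]
  intro p hp
  -- the translate of `p` by `s • v`, a polynomial over `K` vanishing on `T`
  have hmem : aeval (fun i => (X i : MvPolynomial ι K) + C ((s • v) i)) p ∈ vanishingIdeal K T := by
    rw [mem_vanishingIdeal_iff]
    intro t ht
    rw [aeval_aeval_translate]
    exact (mem_zeroLocus_iff.1 (hT t ht s)) p hp
  have h0 := (mem_zeroLocus_iff.1 hz) _ hmem
  rwa [aeval_aeval_translate] at h0

/-- Translation lemma, infinite-intersection form: if through every point of `T` the line in
direction `v` meets `Z_K(J)` in infinitely many points, then the line through every point of the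
Zariski closure of `T` lies in `Z_K(J)`. [cite: Hartshorne1977, I §1] -/
theorem add_smul_mem_zeroLocus_of_mem_closure_of_infinite (J : Ideal (MvPolynomial ι k))
    {T : Set (ι → K)} {v : ι → K} (hT : ∀ z ∈ T, {s : K | z + s • v ∈ zeroLocus K J}.Infinite)
    {z : ι → K} (hz : z ∈ zeroLocus K (vanishingIdeal K T)) (s : K) :
    z + s • v ∈ zeroLocus K J :=
  add_smul_mem_zeroLocus_of_mem_closure J
    (fun t ht => add_smul_mem_zeroLocus_of_infinite J (hT t ht)) hz s

/-- **A closed set whose dense subset carries the lines in the directions `V` is invariant under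
translation by `span_K V`.** If `Z_K(J)` lies in the Zariski closure of `T` and through every
point of `T` the line in each direction `v ∈ V` lies in `Z_K(J)`, then `z + w ∈ Z_K(J)` for all
`z ∈ Z_K(J)` and `w ∈ span_K V`. [cite: Hartshorne1977, I §1] -/
theorem add_mem_zeroLocus_of_mem_span (J : Ideal (MvPolynomial ι k)) {T : Set (ι → K)}
    (hdense : zeroLocus K J ⊆ zeroLocus K (vanishingIdeal K T)) {V : Set (ι → K)}
    (hT : ∀ v ∈ V, ∀ z ∈ T, ∀ s : K, z + s • v ∈ zeroLocus K J) {z : ι → K}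
    (hz : z ∈ zeroLocus K J) {w : ι → K} (hw : w ∈ Submodule.span K V) : z + w ∈ zeroLocus K J := by
  -- every point of `Z_K(J)` carries the line in each direction of the span
  suffices H : ∀ w ∈ Submodule.span K V, ∀ z ∈ zeroLocus K J, ∀ s : K,
      z + s • w ∈ zeroLocus K J by
    simpa using H w hw z hz 1
  intro w hw
  induction hw using Submodule.span_induction with
  | mem v hv =>
    intro z hz s
    exact add_smul_mem_zeroLocus_of_mem_closure J (hT v hv) (hdense hz) s
  | zero => intro z hz s; simpa using hz
  | add a b _ _ ha hb =>
    intro z hz s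
    have h1 := hb (z + s • a) (ha z hz s) s
    rwa [smul_add, ← add_assoc]
  | smul c a _ ha =>
    intro z hz s
    have h1 := ha z hz (s * c)
    rwa [smul_smul]

/-- If every point of `Z_K(J)` carries the line in direction `v`, then `Z_K(J) + s v = Z_K(J)`.
[folklore] -/
theorem image_add_smul_zeroLocus_eq (J : Ideal (MvPolynomial ι k)) {v : ι → K}
    (h : ∀ z ∈ zeroLocus K J, ∀ s : K, z + s • v ∈ zeroLocus K J) (s : K) :
    (fun z => z + s • v) '' zeroLocus K J = zeroLocus K J := by
  refine Set.Subset.antisymm ?_ fun z hz => ⟨z + (-s) • v, h z hz (-s), ?_⟩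
  · rintro _ ⟨z, hz, rfl⟩
    exact h z hz s
  · simp only [neg_smul]
    abel

/-- **Translation lemma, set form**: if `Z_K(J)` lies in the Zariski closure of `T` and the line
in direction `v` through every point of `T` lies in `Z_K(J)`, then `Z_K(J) + s v = Z_K(J)` for
every `s`. [cite: Hartshorne1977, I §1] -/
theorem image_add_smul_zeroLocus_eq_of_dense (J : Ideal (MvPolynomial ι k)) {T : Set (ι → K)}
    (hdense : zeroLocus K J ⊆ zeroLocus K (vanishingIdeal K T)) {v : ι → K}
    (hT : ∀ z ∈ T, ∀ s : K, z + s • v ∈ zeroLocus K J) (s : K) :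
    (fun z => z + s • v) '' zeroLocus K J = zeroLocus K J :=
  image_add_smul_zeroLocus_eq J
    (fun _ hz s => add_smul_mem_zeroLocus_of_mem_closure J hT (hdense hz) s) s

end Literature.RingTheory.MvPolynomial

end
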